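import Summits.BirchSwinnertonDyer.Rank1Residual.GaloisImage.CongruenceVisibilityTwistedWitnessRootsOfUnity
import Summits.BirchSwinnertonDyer.Rank1Residual.GaloisImage.CubicRootStabilizerThree
import HarnessLib

/-!
# Visibility at the additive prime `3` with an UNRAMIFIED-CUBIC witness — the record shape over `ℚ`
# (cell `b2b-bsdres`, team n1011, seat p10 GEN 8; row T-VIS3-UC, FILE 6 = the END of the row; note
# `HOME/b2b-bsdres-n1011-p10/g8/L41-NOTE.md`, skeleton `cells/n1011/skel/T-VIS3-UC.md`)

HONEST FRAMING (cell `b2b-bsdres`, run/shared/lean/b2b/bsd-rank1-residual/, verbatim in every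
file): the goal of the cell is to DELETE the COMBINATION-SHAPED residual classes of the
Birch–Swinnerton-Dyer formula for ALL analytic-rank `≤ 1` elliptic curves over `ℚ` — "full BSD
formula for every rank `≤ 1` curve in class `C`" assembled STRICTLY from published theorems — so
that the rank-`≤ 1` remainder becomes exactly the CONSTRUCTION-SHAPED classes, which are TYPED
(missing-input `Prop`s), NOT attempted. This is not "finishing BSD". Team n1011 (N10 / N11):
research route on the CONSTRUCTION-SHAPED class X4 (§I N11 LOWER half); no claim beyond the stated
classes; nothing is booked; marks UNCHANGED. Theorems only: no definition, no named fact, no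
`sorry`. The theorem closes nothing by itself: the congruence `θ`, the set `S` with its free
places, the finiteness/coprimality of `E(ℚ)`, `t₃ = 3`, the witness `P` and the two local cube-root
certificates are INPUTS (per-row EVIDENCE until kernel-certified by the records lane).

## What

`exists_sha_ne_zero_of_congr_of_unramifiedCubicWitness`: let `E = W`, `E' = W'` be elliptic curves
over `ℚ`, `θ : E'[3] ⥲ E[3]` a `Γ_ℚ`-isomorphism, `S` a finite set of primes containing the bad
primes of both curves and `3`, `E(ℚ)` finite of order prime to `3`, `P ∈ E'(ℚ) ∖ 3E'(ℚ)`, and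
`v₀` the place of `3`. Off `v₀` every `v ∈ S` is free by criterion (a) (a cube root of `P` in
`E'(ℚ_v)`) or (c) (`ι_v(θ) = 1`: the tree's kinds (i)/(ii)/(iii)/(iv′)). At `v₀`: `#E(ℚ₃)[3] = 3`
(T-LOC3L decider currency); a root `α ∈ K̄_{ℚ₃}` of `X³ − X − 1` (any — they exist,
`exists_cubicRoot`; `ℚ₃(α)` is the unramified cubic extension); (d1) a point `Q' ∈ E'(K̄_{ℚ₃})`
fixed by every `σ` fixing `α` (i.e. `Q' ∈ E'(ℚ₃(α))`) with `3 Q' = P`; (d2) a point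
`Q₁ ∈ E(K̄_{ℚ₃})` fixed by every `σ` fixing `α`, with `3 Q₁` fixed by `Γ_{ℚ₃}` (i.e.
`3 Q₁ ∈ E(ℚ₃)`) and `Q₁` itself NOT fixed by `Γ_{ℚ₃}`. **Then `Ш(E/ℚ)` has a non-zero element
killed by `3`.** All group-theoretic binders of FILES 1–3 (`H ⊴ Γ`, index `3`, `F ∉ H`,
`E[3](M) = E[3](ℚ₃)` for both curves, rank one) are DISCHARGED here by FILES 4–5
(`exists_cubicRootStabilizer_three`: `Stab(α)` is normal of index `3` and fixes no primitive cube
root of unity, from `−23 ∈ ℚ₃²`, `−3 ∉ ℚ₃²`, `X³ − X − 1` rootless in `ℚ₃`).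

Census (note §4, `g8/l41_k3wit.tsv`): on r1's 1 577 best F3:L41 rows the line `⟨aP₁ + bP₂⟩` of
column `linesK3` is 3-divisible in `E'(ℚ₃(α))` (candidate (d1)); `R₁ = (1/9, y)` is 3-divisible in
`E(ℚ₃(α))` but not in `E(ℚ₃)` on every σ = E0 curve (candidate (d2)). Both are exact-Hensel
certificates over `ℤ₃[α]` (residue field `𝔽₂₇`), the T-VIS3-WC road (b) decider transplanted —
not made here.
-/

noncomputable section

open scoped Classical

namespace Summit.BirchSwinnertonDyer.Rank1Residual.GaloisImage.TwistedWitness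

open WeierstrassCurve Literature.NumberTheory.EllipticCurves Literature.NumberTheory.GaloisRepresentations
open Field NumberField IsDedekindDomain Rat.HeightOneSpectrum

/-- **Visibility at `3` with an unramified-cubic witness (row T-VIS3-UC END).** See the module
docstring. Over `ℚ`, `p = 3`, `v₀` the place of `3` (`primesEquiv v₀ = 3`), `α³ = α + 1` in
`K̄_{ℚ_{v₀}}`, `H = Stab(α)`: off `v₀` criterion (a) or (c); at `v₀` the count `#E(ℚ_{v₀})[3] = 3`,
an `H`-fixed cube root `Q'` of `P` in `E'(K̄_{v₀})`, and an `H`-fixed `Q₁ ∈ E(K̄_{v₀})` with `3 Q₁`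
rational over `ℚ_{v₀}` and `Q₁` not. Then `Ш(E/ℚ)[3] ≠ 0`. (Cremona–Mazur 2000 §3 /
Agashe–Stein 2002 Lemma 3.6 in explicit form; the local step at `3` is criterion (d) of FILE 1 with
`M = ℚ₃(α)`.) [folklore] -/
theorem exists_sha_ne_zero_of_congr_of_unramifiedCubicWitness (W W' : WeierstrassCurve ℚ)
    [W.IsElliptic] [W'.IsElliptic]
    (θ : geomTorsion W' ((3 : ℕ) : ℤ) ≃+ geomTorsion W ((3 : ℕ) : ℤ))
    (hθ : ∀ (σ : absoluteGaloisGroup ℚ) (P : geomTorsion W' ((3 : ℕ) : ℤ)), θ (σ • P) = σ • θ P)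
    (S : Finset (HeightOneSpectrum (𝓞 ℚ)))
    (hS : ∀ v : HeightOneSpectrum (𝓞 ℚ), v ∉ S →
      W.HasGoodReductionAt v ∧ W'.HasGoodReductionAt v ∧ ((3 : ℕ) : 𝓞 ℚ) ∉ v.asIdeal)
    (hfin : Finite W.toAffine.Point) (hcop : (Nat.card W.toAffine.Point).Coprime 3)
    (P : W'.toAffine.Point)
    (hP : P ∉ (zsmulAddGroupHom ((3 : ℕ) : ℤ) : W'.toAffine.Point →+ W'.toAffine.Point).range)
    (v₀ : HeightOneSpectrum (𝓞 ℚ)) (hv₀ : (primesEquiv v₀ : ℕ) = 3)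
    (hoff : ∀ v ∈ S, v ≠ v₀ →
      (∃ Q : (W'.baseChange (v.adicCompletion ℚ)).toAffine.Point,
        3 • Q = WeierstrassCurve.Affine.Point.baseChange (W' := W') ℚ (v.adicCompletion ℚ) P) ∨
      (selmerLocalKer W (v.adicCompletion ℚ) ((3 : ℕ) : ℤ)).relIndex
        ((selmerLocalKer W' (v.adicCompletion ℚ) ((3 : ℕ) : ℤ)).map (h1Equiv θ hθ).toAddMonoidHom) = 1)
    (hcard : Nat.card (nsmulAddMonoidHom 3 :
      (W.baseChange (v₀.adicCompletion ℚ)).toAffine.Point →+ _).ker = 3)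
    (α : AlgebraicClosure (v₀.adicCompletion ℚ)) (hα : α ^ 3 = α + 1)
    (Q' : localPoints W' (v₀.adicCompletion ℚ))
    (hQ'H : ∀ h : absoluteGaloisGroup (v₀.adicCompletion ℚ), h • α = α → h • Q' = Q')
    (hQ' : ((3 : ℕ) : ℤ) • Q' = pointsMap W' (v₀.adicCompletion ℚ) (toGeomPoints W' P))
    (Q₁ : localPoints W (v₀.adicCompletion ℚ))
    (hQ₁H : ∀ h : absoluteGaloisGroup (v₀.adicCompletion ℚ), h • α = α → h • Q₁ = Q₁)
    (hQ₁ : ((3 : ℕ) : ℤ) • Q₁ ∈ MulAction.fixedPoints (absoluteGaloisGroup (v₀.adicCompletion ℚ))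
      (localPoints W (v₀.adicCompletion ℚ)))
    (hQ₁m : ∃ σ : absoluteGaloisGroup (v₀.adicCompletion ℚ), σ • Q₁ ≠ Q₁) :
    ∃ c : W.sha, c ≠ 0 ∧ 3 • c = 0 := by
  haveI : CharZero (v₀.adicCompletion ℚ) :=
    charZero_of_injective_algebraMap (algebraMap ℚ (v₀.adicCompletion ℚ)).injective
  -- the unramified-cubic subgroup `H = Stab(α)` from the three `ℚ₃`-facts
  obtain ⟨⟨δ, hδ⟩, h3, hnoroot⟩ := three_facts_adicCompletion_three hv₀
  set H := MulAction.stabilizer (absoluteGaloisGroup (v₀.adicCompletion ℚ)) α with hHdef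
  have hHn : H.Normal := normal_stabilizer_cubicRoot hα hδ
  have hind : H.index = 3 := index_stabilizer_cubicRoot hα hδ hnoroot
  have hgenH : ∀ h : absoluteGaloisGroup (v₀.adicCompletion ℚ), h ∈ H ↔ h • α = α := fun h ↦
    MulAction.mem_stabilizer_iff
  -- an element `F ∉ H`, chosen so that it moves `Q₁`
  obtain ⟨σ₁, hσ₁⟩ := hQ₁m
  have hF : σ₁ ∉ H := fun hmem ↦ hσ₁ (hQ₁H σ₁ ((hgenH σ₁).mp hmem))
  haveI : H.Normal := hHn
  -- `hP` is stated with `ℚ`'s decidable equality; the generic theorem uses the classical one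
  refine exists_sha_ne_zero_of_congr_of_twistedDivisible_of_rootsOfUnity W W' (p := 3)
    (by norm_num) θ hθ S hS hfin hcop P (by convert hP) v₀ hoff H hHn hind σ₁ hF
    (exists_mem_stabilizer_smul_ne_of_cube_eq_one hα hδ hnoroot h3) hcard
    Q' (fun h hh ↦ hQ'H h ((hgenH h).mp hh)) hQ' Q₁ (fun h hh ↦ hQ₁H h ((hgenH h).mp hh)) hQ₁ hσ₁

end Summit.BirchSwinnertonDyer.Rank1Residual.GaloisImage.TwistedWitness

end
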